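import Summits.Ventures.CertifiedQuantumChemistry.Rows.ParticleTransferTable
import HarnessLib

/-!
# Ventures/CertifiedQuantumChemistry — Rows/ParticleTransferOperators.lean: the operators of the
# PARTICLE-TRANSFER certificate — Gram operator `Gᵖ_c = Σ_σ a_{cσ}a†_{cσ}` and the commutator operator
# `Oᵖ = Σ_σ a_{cσ}(Ĥ a†_{cσ} − a†_{cσ}Ĥ)` with its NORMAL-ORDERED expansion (the particle twin of HJO (10.8.20))

HONEST FRAMING (verbatim): certified bounds for a stated model Hamiltonian in a stated basis; not a
claim about the real molecule or material beyond that model.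

Typer chem-type-09 (LADDER-CHEM I-TYPE slot 09 class (s), item (L2) particle class; sequel of
`Rows/ParticleTransferTable.lean`, prequel of `Rows/ParticleTransferRows.lean`). The particle transfer of
spin `σ` is the adjoint `a†_{cσ} = (holeOp c σ)ᴴ` of the hole transfer of `Rows/HoleTransferTable.lean`.

## Contents (two operator `def`s; everything else PROVED)
* `particleGram c = Σ_σ a_{cσ}a†_{cσ}`, `particleGram_eq`: `= 2|c|²·1 − Σ_mq c_m c_q E_qm` (one
  normal ordering `a_{mσ}a†_{qσ} = δ_mq − a†_{qσ}a_{mσ}`).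
* `particleCommutatorOp c F = Σ_σ a_{cσ}(Ĥ(F) a†_{cσ} − a†_{cσ} Ĥ(F))` (`= Σ_σ A†(ĤA − AĤ)` for
  `A = a†_{cσ}`), `particleCommutatorOp_expand` (`= Σ_mn c_m c_n Σ_σ a_{mσ}[Ĥ, a†_{nσ}]`).
* **`sum_annihilation_mul_commutator_creation`** — THE PARTICLE TWIN OF HJO (10.8.20), NORMAL-ORDERED:
  for `g_pqrs = g_rspq` and `g_pqrs = g_pqsr` (FCIDUMP symmetries),
  `Σ_σ a_{mσ}(Ĥ a†_{nσ} − a†_{nσ} Ĥ) = 2h_nm·1 − Σ_q h_nq E_qm + 2Σ_rs g_nmrs E_sr − Σ_qr g_nqmr E_qr −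
  Σ_qrs g_nqrs e_qmsr` — from the adjoint of the tree's `annihilation_commutator_molecularHamiltonian`
  (`[a_{nσ}, Ĥ] = Σ_q h_nq a_{qσ} + Σ_qrs g_nqrs Σ_τ a†_{rτ}a_{sτ}a_{qσ}`, HJO (10.3.20)) and two normal
  orderings (`normalOrder_four`); this is the expression chem-solver-5's `transfer_algebra.py` derives by
  brute force and `fcidump_transfer.py` tabulates.

What is NOT here: tables (prequel), the operator identity for `Ĥ(K)` and the rows (sequel); any
certificate instance or claim node. [cite: HelgakerJorgensenOlsen2000, eq. (10.8.20)]
-/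

noncomputable section

namespace Summit.Ventures.CertifiedQuantumChemistry

open Matrix Finset
open Literature.MathematicalPhysics.QuantumLattice Literature.MathematicalPhysics.QuantumChemistry
open Literature.MathematicalPhysics.QuantumLattice.EigenvalueContinuation
open scoped ComplexOrder

variable {k : ℕ}

/-! ## §2 The operators: particle transfer `a†_{cσ} = (a_{cσ})†`, its Gram operator, and the
normal-ordered commutator operator (the particle twin of HJO (10.8.20)) -/

/-- **The Gram operator of the particle transfer** `Gᵖ_c = Σ_σ a_{cσ} a†_{cσ}`
(expectation `Σ_σ ‖a†_{cσ}ψ‖²`). -/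
def particleGram (c : Fin k → ℚ) : Op k := ∑ σ : Fin 2, holeOp c σ * (holeOp c σ)ᴴ

/-- **The commutator operator of the particle transfer** `Oᵖ = Σ_σ a_{cσ}(Ĥ(F) a†_{cσ} − a†_{cσ} Ĥ(F))`
(`= Σ_σ A†(ĤA − AĤ)` for `A = a†_{cσ}`: its expectation at a source eigenvector is the transferred
energy numerator of `transfer_inequality`). -/
def particleCommutatorOp (c : Fin k → ℚ) (F : Model k) : Op k :=
  ∑ σ : Fin 2, holeOp c σ * (F.hamiltonian * (holeOp c σ)ᴴ - (holeOp c σ)ᴴ * F.hamiltonian)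

/-- A rational cast to `ℂ` is self-adjoint. [folklore] -/
private theorem star_ratCast (x : ℚ) : star ((x : ℚ) : ℂ) = ((x : ℚ) : ℂ) := by
  rw [Complex.star_def, map_ratCast]

/-- Bilinear expansion of a product of two linear combinations of operators. [folklore] -/
private theorem sum_smul_mul_sum_smul (a b : Fin k → ℂ) (X Y : Fin k → Op k) :
    (∑ m : Fin k, a m • X m) * (∑ n : Fin k, b n • Y n) =
      ∑ m : Fin k, ∑ n : Fin k, (a m * b n) • (X m * Y n) := by
  rw [Finset.sum_mul]
  refine Finset.sum_congr rfl fun m _ => ?_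
  rw [Finset.mul_sum]
  refine Finset.sum_congr rfl fun n _ => ?_
  rw [smul_mul_assoc, mul_smul_comm, smul_smul]

/-- `H(Σ b Y) − (Σ b Y)H = Σ b (H Y − Y H)`. [folklore] -/
private theorem comm_sum_smul_eq (b : Fin k → ℂ) (Y : Fin k → Op k) (H : Op k) :
    H * (∑ n : Fin k, b n • Y n) - (∑ n : Fin k, b n • Y n) * H =
      ∑ n : Fin k, b n • (H * Y n - Y n * H) := by
  rw [Finset.sum_mul, Finset.mul_sum, ← Finset.sum_sub_distrib]
  refine Finset.sum_congr rfl fun n _ => ?_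
  rw [smul_mul_assoc, mul_smul_comm, smul_sub]

/-- Moving a two-valued spin sum inside a double orbital sum. [folklore] -/
private theorem sum_spin_comm (f : Fin 2 → Fin k → Fin k → Op k) :
    ∑ σ : Fin 2, ∑ m : Fin k, ∑ n : Fin k, f σ m n = ∑ m : Fin k, ∑ n : Fin k, ∑ σ : Fin 2, f σ m n := by
  rw [Finset.sum_comm]
  refine Finset.sum_congr rfl fun m _ => ?_
  rw [Finset.sum_comm]

/-- Normal ordering in the orbital basis: `a_{mσ} a†_{qτ} = δ_{mq}δ_{στ} − a†_{qτ} a_{mσ}`. [folklore] -/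
private theorem annihilation_orb_mul_creation_orb (m q : Fin k) (σ τ : Fin 2) :
    (annihilation (orb m σ) : Op k) * creation (orb q τ) =
      (if m = q ∧ σ = τ then (1 : Op k) else 0) - creation (orb q τ) * annihilation (orb m σ) := by
  rw [annihilation_mul_creation]
  by_cases h : m = q ∧ σ = τ
  · rw [if_pos h, if_pos (by rw [h.1, h.2])]
  · rw [if_neg h, if_neg fun e => h (orb_inj.1 e)]

/-- `a_i a_j = −a_j a_i`. [folklore] -/
private theorem annihilation_mul_annihilation_eq_neg' (i j : Orb (Fin k)) :
    (annihilation i : Op k) * annihilation j = -(annihilation j * annihilation i) :=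
  eq_neg_of_add_eq_zero_left (annihilation_anticommute_holds (ι := Orb (Fin k)) i j)

/-- A spin sum against `δ_{στ}`: `Σ_τ [P ∧ σ = τ] f τ = [P] f σ`. [folklore] -/
private theorem sum_ite_and_eq (P : Prop) [Decidable P] (σ : Fin 2) (f : Fin 2 → Op k) :
    (∑ τ : Fin 2, if P ∧ σ = τ then f τ else 0) = if P then f σ else 0 := by
  by_cases hP : P
  · rw [if_pos hP, Finset.sum_eq_single σ (fun τ _ hτ => if_neg fun h => hτ h.2.symm)
      (fun h => absurd (Finset.mem_univ σ) h), if_pos ⟨hP, rfl⟩]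
  · rw [if_neg hP]
    exact Finset.sum_eq_zero fun τ _ => if_neg fun h => hP h.1

/-- **Double normal ordering**: `a_{mσ} a†_{qσ} a†_{sτ} a_{rτ} =
δ_{mq}·a†_{sτ}a_{rτ} − δ_{(mσ)(sτ)}·a†_{qσ}a_{rτ} − a†_{qσ}a†_{sτ}a_{rτ}a_{mσ}`. [folklore] -/
private theorem normalOrder_four (m q s r : Fin k) (σ τ : Fin 2) :
    (annihilation (orb m σ) : Op k) * (creation (orb q σ) * (creation (orb s τ) * annihilation (orb r τ))) =
      (if m = q then creation (orb s τ) * annihilation (orb r τ) else 0) -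
        (if m = s ∧ σ = τ then creation (orb q σ) * annihilation (orb r τ) else 0) -
        creation (orb q σ) * creation (orb s τ) * annihilation (orb r τ) * annihilation (orb m σ) := by
  have h1 := annihilation_orb_mul_creation_orb (k := k) m q σ σ
  have h2 := annihilation_orb_mul_creation_orb (k := k) m s σ τ
  have h3 := annihilation_mul_annihilation_eq_neg' (k := k) (orb m σ) (orb r τ)
  simp only [and_true] at h1
  calc (annihilation (orb m σ) : Op k) * (creation (orb q σ) * (creation (orb s τ) * annihilation (orb r τ)))
      = (annihilation (orb m σ) * creation (orb q σ)) * (creation (orb s τ) * annihilation (orb r τ)) := by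
        noncomm_ring
    _ = ((if m = q then (1 : Op k) else 0) - creation (orb q σ) * annihilation (orb m σ)) *
          (creation (orb s τ) * annihilation (orb r τ)) := by rw [h1]
    _ = (if m = q then creation (orb s τ) * annihilation (orb r τ) else 0) -
          creation (orb q σ) * (annihilation (orb m σ) * creation (orb s τ)) * annihilation (orb r τ) := by
        split_ifs <;> noncomm_ring
    _ = (if m = q then creation (orb s τ) * annihilation (orb r τ) else 0) -
          creation (orb q σ) * ((if m = s ∧ σ = τ then (1 : Op k) else 0) -
            creation (orb s τ) * annihilation (orb m σ)) * annihilation (orb r τ) := by rw [h2]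
    _ = (if m = q then creation (orb s τ) * annihilation (orb r τ) else 0) -
          (if m = s ∧ σ = τ then creation (orb q σ) * annihilation (orb r τ) else 0) +
          creation (orb q σ) * creation (orb s τ) * (annihilation (orb m σ) * annihilation (orb r τ)) := by
        split_ifs <;> noncomm_ring
    _ = _ := by rw [h3]; noncomm_ring

/-- **THE PARTICLE TWIN OF HJO (10.8.20), NORMAL-ORDERED**: for a symmetric model whose two-electron
table has the FCIDUMP symmetries `g_pqrs = g_rspq` and `g_pqrs = g_pqsr` (both part of `Model.IsEightfold`),
`Σ_σ a_{mσ}(Ĥ a†_{nσ} − a†_{nσ} Ĥ) = 2h_nm·1 − Σ_q h_nq E_qm + 2Σ_rs g_nmrs E_sr − Σ_qr g_nqmr E_qr −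
Σ_qrs g_nqrs e_qmsr` (adjoint of the tree's `annihilation_commutator_molecularHamiltonian`
`[a_{nσ}, Ĥ] = Σ_q h_nq a_{qσ} + Σ_qrs g_nqrs Σ_τ a†_{rτ}a_{sτ}a_{qσ}`, then two normal orderings; the form
solver-5's `transfer_algebra.py` derives by brute force). [cite: HelgakerJorgensenOlsen2000, eq. (10.8.20)] -/
theorem sum_annihilation_mul_commutator_creation {F : Model k} (hF : F.IsSymmetric)
    (hg : ∀ p q r s, F.eri p q r s = F.eri r s p q) (hg2 : ∀ p q r s, F.eri p q r s = F.eri p q s r)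
    (m n : Fin k) :
    ∑ σ : Fin 2, annihilation (orb m σ) *
        (F.hamiltonian * creation (orb n σ) - creation (orb n σ) * F.hamiltonian) =
      ((2 * F.h n m : ℚ) : ℂ) • (1 : Op k) -
        ∑ q : Fin k, ((F.h n q : ℚ) : ℂ) • singletExcitation q m +
        (2 : ℂ) • ∑ r : Fin k, ∑ s : Fin k, ((F.eri n m r s : ℚ) : ℂ) • singletExcitation s r -
        ∑ q : Fin k, ∑ r : Fin k, ((F.eri n q m r : ℚ) : ℂ) • singletExcitation q r -
        ∑ q : Fin k, ∑ r : Fin k, ∑ s : Fin k,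
          ((F.eri n q r s : ℚ) : ℂ) • twoElectronExcitation q m s r := by
  have hH : F.hamiltonian.IsHermitian := Model.hamiltonian_isHermitian hF
  have hg' : ∀ p q r s : Fin k, ((F.eri p q r s : ℚ) : ℂ) = ((F.eri r s p q : ℚ) : ℂ) :=
    fun p q r s => by rw [hg p q r s]
  -- the adjoint of `[a_{nσ}, Ĥ]`
  have hcomm : ∀ σ : Fin 2, F.hamiltonian * creation (orb n σ) - creation (orb n σ) * F.hamiltonian =
      ∑ q : Fin k, ((F.h n q : ℚ) : ℂ) • creation (orb q σ) +
        ∑ q : Fin k, ∑ r : Fin k, ∑ s : Fin k, ((F.eri n q r s : ℚ) : ℂ) •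
          ∑ τ : Fin 2, creation (orb q σ) * (creation (orb s τ) * annihilation (orb r τ)) := by
    intro σ
    have h := congrArg conjTranspose (annihilation_commutator_molecularHamiltonian
      (fun p q => ((F.h p q : ℚ) : ℂ)) ((F.ecore : ℚ) : ℂ) hg' n σ)
    rw [show molecularHamiltonian (fun p q => ((F.h p q : ℚ) : ℂ))
        (fun p q r s => ((F.eri p q r s : ℚ) : ℂ)) ((F.ecore : ℚ) : ℂ) = F.hamiltonian from rfl,
      conjTranspose_sub, conjTranspose_mul, conjTranspose_mul, hH.eq, annihilation_conjTranspose] at h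
    rw [h]
    simp only [conjTranspose_add, conjTranspose_sum, conjTranspose_smul, conjTranspose_mul,
      annihilation_conjTranspose, creation_conjTranspose, star_ratCast, Matrix.mul_assoc]
  simp_rw [hcomm, Matrix.mul_add, Finset.mul_sum, Matrix.mul_smul, Finset.sum_add_distrib]
  -- one-body part: `Σ_σ Σ_q h_nq a_{mσ}a†_{qσ} = 2h_nm − Σ_q h_nq E_qm`
  have hone : ∑ σ : Fin 2, ∑ q : Fin k, ((F.h n q : ℚ) : ℂ) • ((annihilation (orb m σ) : Op k) *
      creation (orb q σ)) =
      ((2 * F.h n m : ℚ) : ℂ) • (1 : Op k) - ∑ q : Fin k, ((F.h n q : ℚ) : ℂ) • singletExcitation q m := by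
    have e : ∀ σ : Fin 2, ∀ q : Fin k, ((F.h n q : ℚ) : ℂ) • ((annihilation (orb m σ) : Op k) *
        creation (orb q σ)) = ((F.h n q : ℚ) : ℂ) • (if m = q then (1 : Op k) else 0) -
          ((F.h n q : ℚ) : ℂ) • (creation (orb q σ) * annihilation (orb m σ)) := by
      intro σ q
      have h1 := annihilation_orb_mul_creation_orb (k := k) m q σ σ
      simp only [and_true] at h1
      rw [h1, smul_sub]
    simp_rw [e, Finset.sum_sub_distrib]
    rw [Finset.sum_comm (f := fun σ q => ((F.h n q : ℚ) : ℂ) • (creation (orb q σ) * annihilation (orb m σ)))]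
    simp_rw [← Finset.smul_sum]
    rw [show ∑ σ : Fin 2, ∑ q : Fin k, ((F.h n q : ℚ) : ℂ) • (if m = q then (1 : Op k) else 0) =
        ((2 * F.h n m : ℚ) : ℂ) • (1 : Op k) by
      rw [Finset.sum_const, Finset.card_univ, Fintype.card_fin,
        Finset.sum_eq_single m (fun q _ hq => by rw [if_neg (Ne.symm hq), smul_zero])
          (fun h => absurd (Finset.mem_univ m) h), if_pos rfl, Rat.cast_mul, Rat.cast_ofNat,
        mul_smul, two_smul, two_smul]]
    rfl
  -- two-body part
  have htwo : ∑ σ : Fin 2, ∑ q : Fin k, ∑ r : Fin k, ∑ s : Fin k, ((F.eri n q r s : ℚ) : ℂ) •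
      ((annihilation (orb m σ) : Op k) * ∑ τ : Fin 2, creation (orb q σ) *
        (creation (orb s τ) * annihilation (orb r τ))) =
      (2 : ℂ) • ∑ r : Fin k, ∑ s : Fin k, ((F.eri n m r s : ℚ) : ℂ) • singletExcitation s r -
        ∑ q : Fin k, ∑ r : Fin k, ((F.eri n q m r : ℚ) : ℂ) • singletExcitation q r -
        ∑ q : Fin k, ∑ r : Fin k, ∑ s : Fin k,
          ((F.eri n q r s : ℚ) : ℂ) • twoElectronExcitation q m s r := by
    -- normal-order every string
    have e : ∀ σ : Fin 2, ∀ q r s : Fin k, ((annihilation (orb m σ) : Op k) * ∑ τ : Fin 2,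
        creation (orb q σ) * (creation (orb s τ) * annihilation (orb r τ))) =
        (if m = q then ∑ τ : Fin 2, creation (orb s τ) * annihilation (orb r τ) else 0) -
          (if m = s then creation (orb q σ) * annihilation (orb r σ) else 0) -
          ∑ τ : Fin 2, creation (orb q σ) * creation (orb s τ) * annihilation (orb r τ) *
            annihilation (orb m σ) := by
      intro σ q r s
      rw [Finset.mul_sum]
      simp_rw [normalOrder_four, Finset.sum_sub_distrib]
      congr 1
      congr 1
      · split_ifs <;> simp
      · exact sum_ite_and_eq (m = s) σ fun τ => creation (orb q σ) * annihilation (orb r τ)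
    simp_rw [e, smul_sub, Finset.sum_sub_distrib]
    -- (i) the `δ_mq` term: `Σ_σ Σ_qrs g_nqrs δ_mq Σ_τ a†_{sτ}a_{rτ} = 2 Σ_rs g_nmrs E_sr`
    have hi : ∑ σ : Fin 2, ∑ q : Fin k, ∑ r : Fin k, ∑ s : Fin k, ((F.eri n q r s : ℚ) : ℂ) •
        (if m = q then ∑ τ : Fin 2, (creation (orb s τ) : Op k) * annihilation (orb r τ) else 0) =
        (2 : ℂ) • ∑ r : Fin k, ∑ s : Fin k, ((F.eri n m r s : ℚ) : ℂ) • singletExcitation s r := by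
      rw [Finset.sum_const, Finset.card_univ, Fintype.card_fin,
        Finset.sum_eq_single m (fun q _ hq => Finset.sum_eq_zero fun r _ => Finset.sum_eq_zero
          fun s _ => by rw [if_neg (Ne.symm hq), smul_zero]) (fun h => absurd (Finset.mem_univ m) h)]
      simp only [if_true, two_smul]
      rfl
    -- (ii) the `δ_ms` term: `Σ_σ Σ_qrs g_nqrs δ_ms a†_{qσ}a_{rσ} = Σ_qr g_nqmr E_qr`
    have hii : ∑ σ : Fin 2, ∑ q : Fin k, ∑ r : Fin k, ∑ s : Fin k, ((F.eri n q r s : ℚ) : ℂ) •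
        (if m = s then (creation (orb q σ) : Op k) * annihilation (orb r σ) else 0) =
        ∑ q : Fin k, ∑ r : Fin k, ((F.eri n q m r : ℚ) : ℂ) • singletExcitation q r := by
      have e2 : ∀ σ : Fin 2, ∀ q r : Fin k, ∑ s : Fin k, ((F.eri n q r s : ℚ) : ℂ) •
          (if m = s then (creation (orb q σ) : Op k) * annihilation (orb r σ) else 0) =
          ((F.eri n q r m : ℚ) : ℂ) • (creation (orb q σ) * annihilation (orb r σ)) := by
        intro σ q r
        rw [Finset.sum_eq_single m (fun s _ hs => by rw [if_neg (Ne.symm hs), smul_zero])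
          (fun h => absurd (Finset.mem_univ m) h), if_pos rfl]
      simp_rw [e2]
      rw [sum_spin_comm]
      refine Finset.sum_congr rfl fun q _ => Finset.sum_congr rfl fun r _ => ?_
      rw [← Finset.smul_sum, hg2 n q r m]
      rfl
    -- (iii) the string term is `e_qmsr`
    have hiii : ∑ σ : Fin 2, ∑ q : Fin k, ∑ r : Fin k, ∑ s : Fin k, ((F.eri n q r s : ℚ) : ℂ) •
        ∑ τ : Fin 2, (creation (orb q σ) : Op k) * creation (orb s τ) * annihilation (orb r τ) *
          annihilation (orb m σ) =
        ∑ q : Fin k, ∑ r : Fin k, ∑ s : Fin k,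
          ((F.eri n q r s : ℚ) : ℂ) • twoElectronExcitation q m s r := by
      rw [Finset.sum_comm]
      refine Finset.sum_congr rfl fun q _ => ?_
      rw [Finset.sum_comm]
      refine Finset.sum_congr rfl fun r _ => ?_
      rw [Finset.sum_comm]
      refine Finset.sum_congr rfl fun s _ => ?_
      rw [← Finset.smul_sum, twoElectronExcitation]
    rw [hi, hii, hiii]
  rw [hone, htwo]
  abel

/-- **`Gᵖ_c = 2|c|²·1 − Σ_mq c_m c_q E_qm`** (one normal ordering: `a_{mσ}a†_{qσ} = δ_mq − a†_{qσ}a_{mσ}`).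
[folklore] -/
theorem particleGram_eq (c : Fin k → ℚ) :
    particleGram c = ((2 * ∑ q : Fin k, c q * c q : ℚ) : ℂ) • (1 : Op k) -
      ∑ m : Fin k, ∑ q : Fin k, ((c m * c q : ℚ) : ℂ) • singletExcitation q m := by
  unfold particleGram
  simp_rw [holeOp_conjTranspose]
  unfold holeOp
  simp_rw [sum_smul_mul_sum_smul]
  rw [sum_spin_comm]
  have e : ∀ m q : Fin k, ∑ σ : Fin 2, (((c m : ℚ) : ℂ) * ((c q : ℚ) : ℂ)) •
      ((annihilation (orb m σ) : Op k) * creation (orb q σ)) =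
      ((c m * c q : ℚ) : ℂ) • (if m = q then (2 : ℂ) • (1 : Op k) else 0) -
        ((c m * c q : ℚ) : ℂ) • singletExcitation q m := by
    intro m q
    have h1 : ∀ σ : Fin 2, (annihilation (orb m σ) : Op k) * creation (orb q σ) =
        (if m = q then (1 : Op k) else 0) - creation (orb q σ) * annihilation (orb m σ) := fun σ => by
      have h := annihilation_orb_mul_creation_orb (k := k) m q σ σ
      simp only [and_true] at h
      exact h
    simp_rw [h1, smul_sub, Finset.sum_sub_distrib, ← Finset.smul_sum, Rat.cast_mul]
    congr 2
    · rw [Finset.sum_const, Finset.card_univ, Fintype.card_fin]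
      split_ifs <;> simp [two_smul]
  simp_rw [e, Finset.sum_sub_distrib]
  congr 1
  -- the constant: `Σ_m Σ_q c_m c_q [m = q] 2·1 = 2|c|²·1`
  rw [show ∑ m : Fin k, ∑ q : Fin k, ((c m * c q : ℚ) : ℂ) • (if m = q then (2 : ℂ) • (1 : Op k) else 0) =
      ∑ m : Fin k, ((c m * c m : ℚ) : ℂ) • ((2 : ℂ) • (1 : Op k)) from
    Finset.sum_congr rfl fun m _ => by
      rw [Finset.sum_eq_single m (fun q _ hq => by rw [if_neg (Ne.symm hq), smul_zero])
        (fun h => absurd (Finset.mem_univ m) h), if_pos rfl]]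
  rw [← Finset.sum_smul, smul_smul, ← Rat.cast_sum]
  congr 1
  push_cast
  ring

/-- **`Oᵖ = Σ_mn c_m c_n Σ_σ a_{mσ}(Ĥ a†_{nσ} − a†_{nσ} Ĥ)`** (bilinear expansion). [folklore] -/
theorem particleCommutatorOp_expand (c : Fin k → ℚ) (F : Model k) :
    particleCommutatorOp c F = ∑ m : Fin k, ∑ n : Fin k, ((c m * c n : ℚ) : ℂ) •
      ∑ σ : Fin 2, annihilation (orb m σ) *
        (F.hamiltonian * creation (orb n σ) - creation (orb n σ) * F.hamiltonian) := by
  unfold particleCommutatorOp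
  simp_rw [holeOp_conjTranspose]
  unfold holeOp
  simp_rw [comm_sum_smul_eq, sum_smul_mul_sum_smul]
  rw [sum_spin_comm]
  refine Finset.sum_congr rfl fun m _ => Finset.sum_congr rfl fun n _ => ?_
  rw [Finset.smul_sum, Rat.cast_mul]

end Summit.Ventures.CertifiedQuantumChemistry

end
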